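import Literature.AlgebraicGeometry.Frobenioids.ArchimedeanPointBase
import Literature.AlgebraicGeometry.Frobenioids.ArchimedeanFSMProofs
import Literature.AlgebraicGeometry.Frobenioids.ArchimedeanFSMMonoCondBR
import Literature.AlgebraicGeometry.Frobenioids.ArchimedeanFSMRepaired
import Literature.AlgebraicGeometry.Frobenioids.ArchimedeanFSMRepairedClosed
import Literature.AlgebraicGeometry.Frobenioids.ArchimedeanFSMOverIsoProofs
import Literature.AlgebraicGeometry.Frobenioids.ArchimedeanFSMIrreducible
import Literature.AlgebraicGeometry.Frobenioids.ArchimedeanFSMPullbackFSMI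
import Literature.AlgebraicGeometry.Frobenioids.ArchimedeanFSMFFComplexRegime
import Literature.AlgebraicGeometry.Frobenioids.ArchimedeanFSMCounterexample
import Literature.AlgebraicGeometry.Frobenioids.ArchimedeanFSMFFCounterexample
import Literature.AlgebraicGeometry.Frobenioids.ArchimedeanFSMIrreducibleCounterexample
import Literature.AlgebraicGeometry.Frobenioids.PadicFrobenioidQpSplit
import HarnessLib

/-!
# Frobenioids II, Proposition 3.4 (i)–(viii) AS TYPED, at THE archimedean base of [IUTchI] Example 3.4:
# every item holds with NO hypothesis left (abc-iut cell, layer L1, node `FrdII:Prop3.4`, chain LC-L1-2;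
# non-vacuity of the S6 sub-DAG at the base IUT consumes)

Mochizuki, *The geometry of Frobenioids II: poly-Frobenioids*, Kyushu J. Math. **62** (2008) 401–460, §3,
Proposition 3.4 (i)–(viii) pp. 29–33 [cite: MochizukiFrdII2008, Prop 3.4 p.30], at the data of
*Inter-universal Teichmüller theory I*, Example 3.4 (i), kurims text (May 2020) p. 80: at an archimedean
place `v`, "`C_v` … the archimedean Frobenioid as in [FrdII], Example 3.3, (ii), where we take the base
category to be the one-morphism category determined by `Spec(K_v)`" [cite: Mochizuki2012, Ex 3.4 (i) p.80] —
in the tree: abc-iut-L1-t6's base functor `ArchFrd.ptBase : Discrete PUnit ⥤ D₀` with value `Spec ℂ`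
(`ArchimedeanPointBase.lean`).

PROOF-ONLY file (no `def`); the Prop. 3.4 sibling of `ArchimedeanPointBaseProp35.lean` (abc-iut-w4-d027) and
`ArchimedeanPointBaseThm36(B).lean` (abc-iut-w4-d074).  RECORD (abc-iut-L1-d3, holder of the S6 sub-DAG
`FrdII:Prop3.4`): the typed items `ArchFrd.Prop34_i … Prop34_viii π` (abc-iut-L1-t6, `ArchimedeanFSM.lean`)
quantify over an ARBITRARY base `π : D ⥤ D₀`; three of them are FALSE at some base — (iii) and (viii) at
`π = 𝟭 D₀` (`not_prop34_iii_id`, `not_prop34_viii_id`, abc-iut-L1-d3) and (v) at the constant real base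
(`not_prop34_v_constReal`, abc-iut-w4-d092) — and were discharged in REPAIRED readings (complex regime /
totally epimorphic base / FSMFF-2024).  Here all eight typed items are shown to hold AS TYPED, simultaneously
and with no residual hypothesis, at the base of the IUT situation: `ptBase` is in the complex regime
(`ptBase_isComplexRegime`: every object lies over `Spec ℂ`, by `rfl`), totally epimorphic and of FSM-type
(abc-iut-L1-t4's `PadicFrd.isTotallyEpimorphic_discretePUnit` / `isOfFSMType_discretePUnit`), hence of
FSMFF-type in the 2024 sense (`IsOfFSMType.isOfFSMFFType2024`).  Closers consumed BY NAME: (i)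
`prop34_i_holds` (abc-iut-L1-d3), (ii) `prop34_ii_holds` (abc-iut-w5-d101), (iii) `prop34_iii_of_isComplex`
(L1-d3), (iv) `prop34_iv_holds` (w5-d101), (v) `prop34_v_of_isTotallyEpimorphic` (abc-iut-w4-d092), (vi)
`prop34_vi_of_isComplex` (L1-d3), (vii) `prop34_vii_holds` (L1-d3 / w5-d101), (viii)
`prop34_viii_of_isComplex` (abc-iut-w5-d152); the complex-regime slots `Prop34_iiiR` / `Prop34_viR`
(abc-iut-L1-t6, `ArchimedeanFSMRegime.lean`) are recorded too.  The «base dependence» of (iii), (v),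
(viii) is stated as kernel conjunctions (`…_baseDependent`).  (abc-iut-w5-d146's audit probe of p418633,
03:05Z, checked (viii) at `ptBase` as evidence only; this is the file of record.)

Honest framing: classical, undisputed mathematics ([FrdII] is a refereed prerequisite); nothing here bears
on [IUTchIII] Cor. 3.12; typed ≠ proved elsewhere; here every statement is a kernel theorem.
-/

namespace Literature.AlgebraicGeometry.Frobenioids

namespace ArchFrd

open CategoryTheory

/-! ### The one-morphism base over `Spec ℂ` is in the complex regime, totally epimorphic, FSM -/

/-- Every object of the one-morphism base lies over `Spec ℂ`: `ptBase` is in the complex regime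
(abc-iut-L1-t6's `IsComplexRegime`). [cite: Mochizuki2012, Ex 3.4 (i) p.80] -/
theorem ptBase_isComplexRegime : IsComplexRegime ptBase := fun _ => rfl

/-- The one-morphism base is of FSMFF-type in the revised (2024) sense (it is of FSM-type: its only arrow
is an identity). [cite: MochizukiFrdII2008, Ex 3.3 (i) p.28] -/
theorem pt_isOfFSMFFType2024 : IsOfFSMFFType2024 (Discrete PUnit.{1}) :=
  PadicFrd.isOfFSMType_discretePUnit.isOfFSMFFType2024

/-! ### Proposition 3.4, item by item, at `ptBase` -/

/-- **Prop. 3.4 (i) at `C_v`**: fiberwise-surjective morphisms of `A`, `N`, `R` over the IUT archimedean base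
project to fiberwise-surjective morphisms. [cite: MochizukiFrdII2008, Prop 3.4 (i) p.29] -/
theorem prop34_i_ptBase : Prop34_i ptBase := prop34_i_holds ptBase

/-- **Prop. 3.4 (ii) at `C_v`** (monomorphisms, conditions (a)/(b)). [cite: MochizukiFrdII2008, Prop 3.4 (ii) p.30] -/
theorem prop34_ii_ptBase : Prop34_ii ptBase := prop34_ii_holds ptBase

/-- **Prop. 3.4 (iii) AS TYPED at `C_v`**: FSM-morphisms project to FSM-morphisms — TRUE here (complex
regime), although the same typed item is false at `π = 𝟭 D₀`. [cite: MochizukiFrdII2008, Prop 3.4 (iii) p.30] -/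
theorem prop34_iii_ptBase : Prop34_iii ptBase := prop34_iii_of_isComplex ptBase ptBase_isComplexRegime

/-- **Prop. 3.4 (iv) at `C_v`**. [cite: MochizukiFrdII2008, Prop 3.4 (iv) p.30] -/
theorem prop34_iv_ptBase : Prop34_iv ptBase := prop34_iv_holds ptBase

/-- **Prop. 3.4 (v) AS TYPED at `C_v`** (irreducibles of `A`, `N`, `R`): TRUE here since the one-morphism
base is totally epimorphic, although the typed item is false over the constant real base.
[cite: MochizukiFrdII2008, Prop 3.4 (v) p.30] -/
theorem prop34_v_ptBase : Prop34_v ptBase :=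
  prop34_v_of_isTotallyEpimorphic ptBase PadicFrd.isTotallyEpimorphic_discretePUnit

/-- **Prop. 3.4 (vi) AS TYPED at `C_v`** (FSMI-morphisms; complex regime). [cite: MochizukiFrdII2008, Prop 3.4 (vi) p.30] -/
theorem prop34_vi_ptBase : Prop34_vi ptBase := prop34_vi_of_isComplex ptBase ptBase_isComplexRegime

/-- **Prop. 3.4 (vii) at `C_v`** (pull-back morphisms over FSM/FSMI arrows). [cite: MochizukiFrdII2008, Prop 3.4 (vii) p.30] -/
theorem prop34_vii_ptBase : Prop34_vii ptBase := prop34_vii_holds ptBase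

/-- **Prop. 3.4 (viii) AS TYPED at `C_v`**: `A`, `N`, `R` over the IUT archimedean base are complexifiable,
RC-connected, totally epimorphic and of FSMFF-type — TRUE here (complex regime, base totally epimorphic and of
FSM-type), although the typed item is false at `π = 𝟭 D₀`. [cite: MochizukiFrdII2008, Prop 3.4 (viii) p.30] -/
theorem prop34_viii_ptBase : Prop34_viii ptBase :=
  prop34_viii_of_isComplex ptBase ptBase_isComplexRegime PadicFrd.isTotallyEpimorphic_discretePUnit
    pt_isOfFSMFFType2024

/-- The complex-regime slots of abc-iut-L1-t6's `ArchimedeanFSMRegime.lean` at `C_v` (their hypothesis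
`IsComplexRegime ptBase` is now a theorem, so they yield the typed items outright).
[cite: MochizukiFrdII2008, Prop 3.4 (iii) p.30] -/
theorem prop34_iiiR_viR_ptBase : Prop34_iiiR ptBase ∧ Prop34_viR ptBase :=
  ⟨prop34_iiiR_holds ptBase, prop34_viR_holds ptBase⟩

/-! ### The whole proposition at once, and the base dependence of (iii), (v), (viii) -/

/-- **[FrdII] Proposition 3.4 (i)–(viii) AS TYPED holds in full at THE archimedean Frobenioid base of
[IUTchI] Example 3.4 (i)** — all eight typed items of abc-iut-L1-t6's `ArchimedeanFSM.lean`, for all three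
categories `A`, `N`, `R`, with no residual hypothesis. [cite: MochizukiFrdII2008, Prop 3.4 p.30] -/
theorem prop34_ptBase :
    Prop34_i ptBase ∧ Prop34_ii ptBase ∧ Prop34_iii ptBase ∧ Prop34_iv ptBase ∧
      Prop34_v ptBase ∧ Prop34_vi ptBase ∧ Prop34_vii ptBase ∧ Prop34_viii ptBase :=
  ⟨prop34_i_ptBase, prop34_ii_ptBase, prop34_iii_ptBase, prop34_iv_ptBase, prop34_v_ptBase,
    prop34_vi_ptBase, prop34_vii_ptBase, prop34_viii_ptBase⟩

/-- **Base dependence of the typed (iii)**: true over the IUT archimedean base, false over `𝟭 D₀`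
(abc-iut-L1-d3's FLAG #16 witness `not_prop34_iii_id`). [cite: MochizukiFrdII2008, Prop 3.4 (iii) p.30] -/
theorem prop34_iii_baseDependent : Prop34_iii ptBase ∧ ¬ Prop34_iii (𝟭 D0) :=
  ⟨prop34_iii_ptBase, not_prop34_iii_id⟩

/-- **Base dependence of the typed (v)**: true over the IUT archimedean base, false over the constant real
base on `Type` (abc-iut-w4-d092's `not_prop34_v_constReal`). [cite: MochizukiFrdII2008, Prop 3.4 (v) p.30] -/
theorem prop34_v_baseDependent :
    Prop34_v ptBase ∧ ¬ Prop34_v ((Functor.const (Type)).obj D0.real) :=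
  ⟨prop34_v_ptBase, not_prop34_v_constReal⟩

/-- **Base dependence of the typed (viii)**: true over the IUT archimedean base, false over `𝟭 D₀`
(abc-iut-L1-d3's FLAG #17 witness `not_prop34_viii_id`). [cite: MochizukiFrdII2008, Prop 3.4 (viii) p.30] -/
theorem prop34_viii_baseDependent : Prop34_viii ptBase ∧ ¬ Prop34_viii (𝟭 D0) :=
  ⟨prop34_viii_ptBase, not_prop34_viii_id⟩

end ArchFrd

end Literature.AlgebraicGeometry.Frobenioids
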